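import Summits.QuantumFields.YangMills.Theorems.UnitScaleTiltMinimiserStabilityRegPrOfB8Thm2AtT3Members
import Summits.QuantumFields.YangMills.Theorems.FluctuationComparisonRegPrIntLS2BetaCriticalELRelated
import Summits.QuantumFields.YangMills.Theorems.FluctuationComparisonRegPrIntLS2BetaSigmaRepSplit
import HarnessLib

/-!
# S2β · THE CRITICAL-ORBIT LETTERS OF THE (T)-CHAIN AT EVERY BLOCK SIZE FROM THE ONE NAMED LITERATURE FACT `B8Thm2AtT3Members`:
# orbit-`dist1²` growth over the regular competitors, gauge-relatedness of E–L-critical points, print's (4)-orbit under lifting symmetries, Prop. 7 cl. 1 from one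
# E–L-critical point, and the structured split `v • W′ = u • W` — the `_five` theorems of ✓`…S2BetaOrbitGrowthOfRegular` ∕ ✓pen 7 `…S2BetaCriticalELRelated` ∕
# ✓px13 g21 `…S2BetaSymmetriesLiftOfCritical` §1 RE-THREADED through their `_of_thm2S` roots, CONDITIONAL on the name, valid at `L = 3`

Cell `ym3-torus` (YM ladder rung R3 = continuum `SU(2)` Yang–Mills on the three-torus at fixed lattice data — a RUNG: NOT d = 4, NOT infinite volume, NOT a mass gap,
NOT Clay).  Width seat `ym3-torus-px13` (gen 22), FILE B1 of the pen «the S2β organ road ⟸ one named Literature fact» (px17 g17's docket «≈ 6 `_five` files re-threaded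
through their `_of_thm2S` twins», in named-fact currency); helper of the crux `stmt-QuantumFields-20520` (`…Theses.UnitScaleTilt.FluctuationComparisonRegPrIntL`),
`--supports … --as helper`, count-neutral, DEFINITION-FREE (0 `def`, 0 `instance`, 0 `notation`, 0 `sorry`, default heartbeats).  Registry v11.4 3732b7df untouched.

WHY.  Every `_five` theorem of the S2β (T)-chain bottoms out in exactly two `L ≥ 5` suppliers — ✓`exists_sigmaRep_split_five` and ✓`orbitGrowth_of_regular_five` — and
both are the `L ≥ 5` instances (✓`hThm2S_body_of_five_le`) of landed `_of_thm2S` theorems whose only input is the [Balaban1985RegularSpaces] Thm-2 socket `hThm2S` at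
the block size.  The named fact ✓`B8Thm2AtT3Members` supplies that socket at EVERY block size (✓`hThm2S_of_b8Thm2AtT3Members hX L hL`), so the whole chain holds at every
`L > 1` — in particular at `L = 3` — CONDITIONALLY on the one name that is already the trust base of crux 19200.  The proofs below are those of the cited `_five`
theorems VERBATIM with the first `obtain` re-keyed; nothing is generalised, no analysis is added.

WHAT.
* §1 `orbitGrowth_of_regular_of_b8Thm2AtT3Members`, `orbitGrowth_of_isCritR2_of_b8Thm2AtT3Members` ((142) with its rate in orbit-`dist1²` currency over the regular
  competitors; ✓`orbitGrowth_of_regular_of_thm2S`), `exists_sigmaRep_split_of_b8Thm2AtT3Members` (brick 1, ✓`exists_sigmaRep_split_of_thm2S`).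
* §2 `critical_gaugeRelated_of_el_of_b8Thm2AtT3Members`, `sameOrbit_of_el_of_symmetriesLift_of_b8Thm2AtT3Members`,
  ★ `atMostOneCriticalOrbit_of_el_symmetriesLift_of_b8Thm2AtT3Members` (✓pen 7 §2–§4 twins).
* §3 ★★ `criticalRep_split_of_b8Thm2AtT3Members` (✓px13 g21 FILE B §1 twin: two E–L-critical regular points satisfy `v • W′ = u • W`, `v↓ = 1`, `u` (1.29)-restricted,
  `v • W′` axial).
FILE B2 (`…S2BetaThm1PairOfB8Thm2AtT3Members`) continues: `hlift`, Prop. 7 cl. 1, Thm 1 sentence 2, the Thm-1 PAIR at every block size ⟸ the name.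

HONEST SCOPE (CREDIT NOTHING): conditional plumbing, proofs copied from the cited tree files; `B8Thm2AtT3Members` is OPEN exactly at `L = 3` (EMBARGO-LITE №58 honoured:
`hX` is a HYPOTHESIS, no Thm-2-at-3 proof attempted); at `L ≥ 5` every statement here is already a hypothesis-free tree theorem; GAP♯∘, EXW∘, DET-REP-B, H4ᶜ∘, LFR♯ᶜ∘, S2β,
crux 20520, 19200, `YM3TorusSU2` NOT proved; no registered stub closed; rung R3 = SU(2) YM₃ on T³ — NOT d = 4, NOT infinite volume, NOT a mass gap, NOT Clay; the Yang–Mills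
mass gap is NOT proved.  Sorry-free, axioms standard.

References: T. Bałaban, CMP **102** (1985) 277–309 [Balaban1985Variational] ((4)–(6) p.278, Thm 1 p.279, Prop. 2 p.281, (18)–(21) pp.280–281, Prop. 7 p.299, (141)–(143)
p.299); CMP **99** (1985) 75–102 [Balaban1985RegularSpaces] ((1.19) p.79, (1.29) p.81, Thm 2 p.83); CMP **98** (1985) 17–51 [Balaban1985Averaging] (Prop. 2 p.26);
CMP **99** (1985) 389–434 [Balaban1985BackgroundPropagators] (Thm 3.11 p.416).
-/

set_option autoImplicit false

noncomputable section

namespace Summit.QuantumFields.YangMills.Theorems.FluctuationComparisonRegPrIntLS2BetaCriticalOrbitOfB8Thm2AtT3Members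

open scoped BigOperators Matrix.Norms.L2Operator Matrix

open Literature.MathematicalPhysics.QuantumFieldTheory.Balaban1983to89
open Literature.MathematicalPhysics.QuantumFieldTheory.Balaban1983to89.T3ContinuumYM3Torus
open Literature.MathematicalPhysics.QuantumFieldTheory.Balaban1983to89.T3UnitLawDensityEML (ℰp)
open Literature.MathematicalPhysics.QuantumFieldTheory.Balaban1983to89.T3TiltDescent (descendTo)
open Literature.MathematicalPhysics.QuantumFieldTheory.Balaban1983to89.T3ConstrainedMinimiser (fibre)
open Literature.MathematicalPhysics.QuantumFieldTheory.Balaban1983to89.T3PrintedRegularMinimiser (RegPr regFibrePr mem_regFibrePr_iff)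
open Literature.MathematicalPhysics.QuantumFieldTheory.Balaban1983to89.T3PrintedRegularOrbits (descTransf)
open Literature.MathematicalPhysics.QuantumFieldTheory.Balaban1983to89.T3Thm1Carrier (SameOrbit varProblem3)
open Literature.MathematicalPhysics.QuantumFieldTheory.Balaban1983to89.T3Thm1CarrierNative (IsCritR2)
open Literature.MathematicalPhysics.QuantumFieldTheory.Balaban1983to89.T3SectALandauChart (emb15 eta In19 descTransf_mul descTransf_inv sameOrbit_symm sameOrbit_trans)
open Literature.MathematicalPhysics.QuantumFieldTheory.Balaban1983to89.T3B8Thm2AtMembers (B8Thm2AtT3Members)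
open T4Continuum
open B7Prop2Explicit (C0 c2' C0_pos c2'_pos)
open B7Prop1Explicit renaming Site → LSite
open B8Thm2SetupTorus (Thm2SetupSUAt)
open B15DeterminingSets (embIter)
open Summit.QuantumFields.YangMills.Theorems.Prop7TPrint (expHermField expHermField_apply expHerm_zero)
open Summit.QuantumFields.YangMills.Theorems.Prop7SPrint (IsAxialPrint RestrictedPrint AvgCondPrint IsLandauPrint)
open Summit.QuantumFields.YangMills.Theorems.Prop7CritEL (deriv_comp_eq_zero_of_isCritR2 continuousAt_of_differentiableAt_bonds)
open Summit.QuantumFields.YangMills.Theorems.MinimiserStabilityRegPrOfB8Thm2AtT3Members (hThm2S_of_b8Thm2AtT3Members)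
open Summit.QuantumFields.YangMills.Theorems.FluctuationComparisonRegPrIntLS2BetaSigmaRepSplit (exists_sigmaRep_split_of_thm2S)
open Summit.QuantumFields.YangMills.Theorems.FluctuationComparisonRegPrIntLS2BetaSigmaGrowthRate (sigmaGrowth_holds)
open Summit.QuantumFields.YangMills.Theorems.FluctuationComparisonRegPrIntLS2BetaOrbitGrowthOfRegular (orbitGrowth_of_regular_of_thm2S)
open Summit.QuantumFields.YangMills.Theorems.FluctuationComparisonRegPrIntLS2BetaCriticalOrbitUnique
  (eq_of_sum_dist1_sq_eq_zero gaugeAct_descTransf_eq_of_mem_fibre descTransf_mul_inv)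

/-! ## §1 (142) in orbit-`dist1²` currency over the regular competitors, and brick 1, at every block size from the name -/

/-- **(142) WITH ITS K-UNIFORM RATE IN ORBIT-`dist1²` CURRENCY OVER THE REGULAR COMPETITORS, AT EVERY BLOCK SIZE `L > 1`, CONDITIONAL ON THE ONE NAMED FACT** —
✓`orbitGrowth_of_regular_of_thm2S` fed by ✓`hThm2S_of_b8Thm2AtT3Members hX L hL` (at `L ≥ 5` = ✓`orbitGrowth_of_regular_five` outright).
[cite: Balaban1985Variational, (141)-(143) p.299, Prop. 2 p.281; Balaban1985RegularSpaces, Thm 2 p.83; Balaban1985BackgroundPropagators, Thm 3.11 p.416] -/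
theorem orbitGrowth_of_regular_of_b8Thm2AtT3Members (hX : B8Thm2AtT3Members) (L : ℕ) (hL : 1 < L) :
    ∃ e₈ c : ℝ, 0 < e₈ ∧ 0 < c ∧
      ∀ (F : T3Family), F.L = L → ∀ (n K : ℕ) (hnK : n < K) (e : ℝ) (V : GaugeField (F.P n) 0 (Matrix.specialUnitaryGroup (Fin 2) ℂ))
        (W : GaugeField (F.P K) 0 (Matrix.specialUnitaryGroup (Fin 2) ℂ)),
        0 < e → e ≤ e₈ → W ∈ regFibrePr F n K hnK.le e V →
        (∀ γ : ℝ → GaugeField (F.P K) 0 (Matrix.specialUnitaryGroup (Fin 2) ℂ), γ 0 = W → (∀ t, γ t ∈ fibre F ℰp n K hnK.le V) →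
          (∀ b, DifferentiableAt ℝ (fun t => ((γ t b : Matrix.specialUnitaryGroup (Fin 2) ℂ) : Matrix (Fin 2) (Fin 2) ℂ)) 0) →
            deriv (fun t => wilsonAction4 (γ t)) 0 = 0) →
        ∀ W' : GaugeField (F.P K) 0 (Matrix.specialUnitaryGroup (Fin 2) ℂ), W' ∈ regFibrePr F n K hnK.le e V →
          ∃ u : GaugeTransf (F.P K) 0 (Matrix.specialUnitaryGroup (Fin 2) ℂ),
            c * (((F.L : ℝ) ^ (K - n)) ^ 2)⁻¹ * (∑ ℓ : PBond (F.P K) 0, dist1 (W' ℓ * ((GaugeField.gaugeAct u W) ℓ)⁻¹) ^ 2)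
              ≤ wilsonAction4 W' - wilsonAction4 W := by
  obtain ⟨B₁, c₁, hB₁, hc₁, hT⟩ := hThm2S_of_b8Thm2AtT3Members hX L hL
  exact orbitGrowth_of_regular_of_thm2S hL hB₁ hc₁ hT

/-- **ORBIT-`dist1²` GROWTH AT AN R2-CRITICAL REGULAR POINT, EVERY BLOCK SIZE `L > 1`, CONDITIONAL ON THE ONE NAMED FACT** — §1 with the E–L binder discharged by Fermat
(✓`Prop7CritEL.deriv_comp_eq_zero_of_isCritR2` ∘ ✓`continuousAt_of_differentiableAt_bonds`; the proof of ✓`orbitGrowth_of_isCritR2_five` verbatim).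
[cite: Balaban1985Variational, (141)-(143) p.299, (5)-(6) p.278, (111) p.294; Balaban1985RegularSpaces, Thm 2 p.83] -/
theorem orbitGrowth_of_isCritR2_of_b8Thm2AtT3Members (hX : B8Thm2AtT3Members) (L : ℕ) (hL : 1 < L) :
    ∃ e₈ c : ℝ, 0 < e₈ ∧ 0 < c ∧
      ∀ (F : T3Family), F.L = L → ∀ (n K : ℕ) (hnK : n < K) (e : ℝ) (V : GaugeField (F.P n) 0 (Matrix.specialUnitaryGroup (Fin 2) ℂ))
        (W : GaugeField (F.P K) 0 (Matrix.specialUnitaryGroup (Fin 2) ℂ)),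
        0 < e → e ≤ e₈ → W ∈ regFibrePr F n K hnK.le e V → IsCritR2 F n K hnK.le V W →
        ∀ W' : GaugeField (F.P K) 0 (Matrix.specialUnitaryGroup (Fin 2) ℂ), W' ∈ regFibrePr F n K hnK.le e V →
          ∃ u : GaugeTransf (F.P K) 0 (Matrix.specialUnitaryGroup (Fin 2) ℂ),
            c * (((F.L : ℝ) ^ (K - n)) ^ 2)⁻¹ * (∑ ℓ : PBond (F.P K) 0, dist1 (W' ℓ * ((GaugeField.gaugeAct u W) ℓ)⁻¹) ^ 2)
              ≤ wilsonAction4 W' - wilsonAction4 W := by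
  obtain ⟨e₈, c, he₈, hc, H⟩ := orbitGrowth_of_regular_of_b8Thm2AtT3Members hX L hL
  refine ⟨e₈, c, he₈, hc, fun F hF n K hnK e V W he heε hW hcrit W' hW' => H F hF n K hnK e V W he heε hW ?_ W' hW'⟩
  intro γ hγ0 hγfib hγd
  exact deriv_comp_eq_zero_of_isCritR2 hcrit γ hγ0 hγfib (continuousAt_of_differentiableAt_bonds γ hγd)

/-- **BRICK 1 — THE Σ-REPRESENTATIVE WITH ITS GAUGE SPLIT — AT EVERY BLOCK SIZE `L > 1`, CONDITIONAL ON THE ONE NAMED FACT** (✓px13 g20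
`exists_sigmaRep_split_of_thm2S` fed by ✓`hThm2S_of_b8Thm2AtT3Members`; at `L ≥ 5` = ✓`exists_sigmaRep_split_five`).
[cite: Balaban1985Variational, Prop. 2 p.281, (18)-(21) pp.280-281; Balaban1985RegularSpaces, Thm 2 p.83, (1.29) p.81; Balaban1985Averaging, Prop. 2 p.26] -/
theorem exists_sigmaRep_split_of_b8Thm2AtT3Members (hX : B8Thm2AtT3Members) (L : ℕ) (hL : 1 < L) :
    ∃ B₁' c₁' : ℝ, 0 < B₁' ∧ 0 < c₁' ∧
    ∀ (F : T3Family), F.L = L → ∀ (n K : ℕ) (hnK : n < K) (e : ℝ)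
      (V : GaugeField (F.P n) 0 (Matrix.specialUnitaryGroup (Fin 2) ℂ)) (W : GaugeField (F.P K) 0 (Matrix.specialUnitaryGroup (Fin 2) ℂ)),
      0 < e → 2 * e ≤ c₁' → C0 3 * (2 * e) ≤ 1 / 3 → 2 * (2 * e) ≤ c2' 3 L → W ∈ regFibrePr F n K hnK.le e V →
      ∀ W' : GaugeField (F.P K) 0 (Matrix.specialUnitaryGroup (Fin 2) ℂ), W' ∈ regFibrePr F n K hnK.le e V →
        ∃ (v u : GaugeTransf (F.P K) 0 (Matrix.specialUnitaryGroup (Fin 2) ℂ)) (X : PBond (F.P K) 0 → Matrix (Fin 2) (Fin 2) ℂ),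
          (∀ y : Site (F.P K) (K - n), v (embIter (K - n) y) = 1) ∧
          (∀ U'' : GaugeField (F.P K) 0 (Matrix.specialUnitaryGroup (Fin 2) ℂ),
              descendTo F ℰp n K hnK.le (GaugeField.gaugeAct v U'') = descendTo F ℰp n K hnK.le U'') ∧
          RestrictedPrint F n K W u ∧
          IsAxialPrint F n K W (GaugeField.gaugeAct v W') ∧
          W' = GaugeField.gaugeAct (fun x => (v x)⁻¹ * u x) (emb15 W (expHermField X)) ∧
          GaugeField.gaugeAct v W' = GaugeField.gaugeAct u (emb15 W (expHermField X)) ∧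
          In19 F n K (2 * B₁' * e) W (expHermField X) X ∧ AvgCondPrint F n K hnK.le V W X ∧ IsLandauPrint F n K W X ∧
          wilsonAction4 W' = wilsonAction4 (emb15 W (expHermField X)) := by
  obtain ⟨B₁, c₁, hB₁, hc₁, hT⟩ := hThm2S_of_b8Thm2AtT3Members hX L hL
  exact exists_sigmaRep_split_of_thm2S hB₁ hc₁ hT

/-! ## §2 The ✓pen 7 twins: gauge-relatedness of E–L-critical points, print's (4)-orbit under lifting symmetries, Prop. 7 cl. 1 from one E–L-critical point -/

/-- **TWO E–L-CRITICAL REGULAR POINTS ARE GAUGE-RELATED, EVERY BLOCK SIZE `L > 1`, CONDITIONAL ON THE ONE NAMED FACT** (the proof of ✓pen 7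
`critical_gaugeRelated_of_el_five` verbatim over §1: growth both ways ⇒ equal actions ⇒ zero orbit sum ⇒ ✓`eq_of_sum_dist1_sq_eq_zero`,
✓`gaugeAct_descTransf_eq_of_mem_fibre`). [cite: Balaban1985Variational, Prop. 7 p.299, (141)-(143) p.299, (4)-(6) p.278; Balaban1985RegularSpaces, Thm 2 p.83] -/
theorem critical_gaugeRelated_of_el_of_b8Thm2AtT3Members (hX : B8Thm2AtT3Members) (L : ℕ) (hL : 1 < L) :
    ∃ e₈ : ℝ, 0 < e₈ ∧
      ∀ (F : T3Family), F.L = L → ∀ (n K : ℕ) (hnK : n < K) (e : ℝ) (V : GaugeField (F.P n) 0 (Matrix.specialUnitaryGroup (Fin 2) ℂ))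
        (W W' : GaugeField (F.P K) 0 (Matrix.specialUnitaryGroup (Fin 2) ℂ)),
        0 < e → e ≤ e₈ → W ∈ regFibrePr F n K hnK.le e V →
        (∀ γ : ℝ → GaugeField (F.P K) 0 (Matrix.specialUnitaryGroup (Fin 2) ℂ), γ 0 = W → (∀ t, γ t ∈ fibre F ℰp n K hnK.le V) →
          (∀ b, DifferentiableAt ℝ (fun t => ((γ t b : Matrix.specialUnitaryGroup (Fin 2) ℂ) : Matrix (Fin 2) (Fin 2) ℂ)) 0) →
            deriv (fun t => wilsonAction4 (γ t)) 0 = 0) →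
        W' ∈ regFibrePr F n K hnK.le e V →
        (∀ γ : ℝ → GaugeField (F.P K) 0 (Matrix.specialUnitaryGroup (Fin 2) ℂ), γ 0 = W' → (∀ t, γ t ∈ fibre F ℰp n K hnK.le V) →
          (∀ b, DifferentiableAt ℝ (fun t => ((γ t b : Matrix.specialUnitaryGroup (Fin 2) ℂ) : Matrix (Fin 2) (Fin 2) ℂ)) 0) →
            deriv (fun t => wilsonAction4 (γ t)) 0 = 0) →
          ∃ u : GaugeTransf (F.P K) 0 (Matrix.specialUnitaryGroup (Fin 2) ℂ),
            W' = GaugeField.gaugeAct u W ∧ GaugeField.gaugeAct (descTransf F n K hnK.le u) V = V := by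
  obtain ⟨e₈, c, he₈, hc, H⟩ := orbitGrowth_of_regular_of_b8Thm2AtT3Members hX L hL
  refine ⟨e₈, he₈, ?_⟩
  intro F hF n K hnK e V W W' he heε hW hELW hW' hELW'
  obtain ⟨u, hu⟩ := H F hF n K hnK e V W he heε hW hELW W' hW'
  obtain ⟨u', hu'⟩ := H F hF n K hnK e V W' he heε hW' hELW' W hW
  have hℓ : (0 : ℝ) < c * (((F.L : ℝ) ^ (K - n)) ^ 2)⁻¹ := by
    have hL0 : (0 : ℝ) < (F.L : ℝ) := by have := F.hL.2; exact_mod_cast (by omega : 0 < F.L)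
    positivity
  have hS0 : 0 ≤ ∑ ℓ : PBond (F.P K) 0, dist1 (W' ℓ * ((GaugeField.gaugeAct u W) ℓ)⁻¹) ^ 2 := Finset.sum_nonneg fun _ _ => sq_nonneg _
  have hS0' : 0 ≤ ∑ ℓ : PBond (F.P K) 0, dist1 (W ℓ * ((GaugeField.gaugeAct u' W') ℓ)⁻¹) ^ 2 := Finset.sum_nonneg fun _ _ => sq_nonneg _
  -- equal actions
  have hA : wilsonAction4 W' = wilsonAction4 W := by
    have h1 : 0 ≤ wilsonAction4 W' - wilsonAction4 W := (mul_nonneg hℓ.le hS0).trans hu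
    have h2 : 0 ≤ wilsonAction4 W - wilsonAction4 W' := (mul_nonneg hℓ.le hS0').trans hu'
    linarith
  have hsum : ∑ ℓ : PBond (F.P K) 0, dist1 (W' ℓ * ((GaugeField.gaugeAct u W) ℓ)⁻¹) ^ 2 = 0 := by
    have h1 : c * (((F.L : ℝ) ^ (K - n)) ^ 2)⁻¹ * ∑ ℓ : PBond (F.P K) 0, dist1 (W' ℓ * ((GaugeField.gaugeAct u W) ℓ)⁻¹) ^ 2 ≤ 0 := by
      rw [hA, sub_self] at hu; exact hu
    have h2 : ∑ ℓ : PBond (F.P K) 0, dist1 (W' ℓ * ((GaugeField.gaugeAct u W) ℓ)⁻¹) ^ 2 ≤ 0 := by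
      by_contra hne
      push Not at hne
      have := mul_pos hℓ hne
      linarith
    exact le_antisymm h2 hS0
  have hrel := eq_of_sum_dist1_sq_eq_zero hsum
  exact ⟨u, hrel, gaugeAct_descTransf_eq_of_mem_fibre hnK.le u ((mem_regFibrePr_iff F).mp hW).1 ((mem_regFibrePr_iff F).mp hW').1 hrel⟩

/-- **PRINT's (4)-ORBIT FROM AN E–L-CRITICAL POINT WITH LIFTING SYMMETRIES, EVERY BLOCK SIZE `L > 1`, CONDITIONAL ON THE ONE NAMED FACT** (the proof of ✓pen 7
`sameOrbit_of_el_of_symmetriesLift_five` verbatim: `u` from the previous theorem, the lift `k` of `u↓` fixing `W`, `w := u·k⁻¹`).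
[cite: Balaban1985Variational, Prop. 7 p.299, (4) p.278; Balaban1985RegularSpaces, Thm 2 p.83] -/
theorem sameOrbit_of_el_of_symmetriesLift_of_b8Thm2AtT3Members (hX : B8Thm2AtT3Members) (L : ℕ) (hL : 1 < L) :
    ∃ e₈ : ℝ, 0 < e₈ ∧
      ∀ (F : T3Family), F.L = L → ∀ (n K : ℕ) (hnK : n < K) (e : ℝ) (V : GaugeField (F.P n) 0 (Matrix.specialUnitaryGroup (Fin 2) ℂ))
        (W W' : GaugeField (F.P K) 0 (Matrix.specialUnitaryGroup (Fin 2) ℂ)),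
        0 < e → e ≤ e₈ → W ∈ regFibrePr F n K hnK.le e V →
        (∀ γ : ℝ → GaugeField (F.P K) 0 (Matrix.specialUnitaryGroup (Fin 2) ℂ), γ 0 = W → (∀ t, γ t ∈ fibre F ℰp n K hnK.le V) →
          (∀ b, DifferentiableAt ℝ (fun t => ((γ t b : Matrix.specialUnitaryGroup (Fin 2) ℂ) : Matrix (Fin 2) (Fin 2) ℂ)) 0) →
            deriv (fun t => wilsonAction4 (γ t)) 0 = 0) →
        (∀ s : GaugeTransf (F.P n) 0 (Matrix.specialUnitaryGroup (Fin 2) ℂ), GaugeField.gaugeAct s V = V →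
            ∃ k : GaugeTransf (F.P K) 0 (Matrix.specialUnitaryGroup (Fin 2) ℂ), GaugeField.gaugeAct k W = W ∧ descTransf F n K hnK.le k = s) →
        W' ∈ regFibrePr F n K hnK.le e V →
        (∀ γ : ℝ → GaugeField (F.P K) 0 (Matrix.specialUnitaryGroup (Fin 2) ℂ), γ 0 = W' → (∀ t, γ t ∈ fibre F ℰp n K hnK.le V) →
          (∀ b, DifferentiableAt ℝ (fun t => ((γ t b : Matrix.specialUnitaryGroup (Fin 2) ℂ) : Matrix (Fin 2) (Fin 2) ℂ)) 0) →
            deriv (fun t => wilsonAction4 (γ t)) 0 = 0) →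
          SameOrbit F n K hnK.le W W' := by
  obtain ⟨e₈, he₈, H⟩ := critical_gaugeRelated_of_el_of_b8Thm2AtT3Members hX L hL
  refine ⟨e₈, he₈, ?_⟩
  intro F hF n K hnK e V W W' he heε hW hELW hlift hW' hELW'
  obtain ⟨u, hrel, hfix⟩ := H F hF n K hnK e V W W' he heε hW hELW hW' hELW'
  obtain ⟨k, hkW, hk⟩ := hlift (descTransf F n K hnK.le u) hfix
  refine ⟨fun x => u x * (k x)⁻¹, ?_, ?_⟩
  · rw [descTransf_mul_inv, hk]
    funext y
    exact mul_inv_cancel _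
  · rw [hrel]
    funext b
    have hkb : k b.src * W b * (k b.tgt)⁻¹ = W b := congrFun hkW b
    show u b.src * W b * (u b.tgt)⁻¹ = u b.src * (k b.src)⁻¹ * W b * (u b.tgt * (k b.tgt)⁻¹)⁻¹
    have hinv : (k b.src)⁻¹ * W b * k b.tgt = W b := by
      calc (k b.src)⁻¹ * W b * k b.tgt = (k b.src)⁻¹ * (k b.src * W b * (k b.tgt)⁻¹) * k b.tgt := by rw [hkb]
        _ = W b := by group
    calc u b.src * W b * (u b.tgt)⁻¹ = u b.src * ((k b.src)⁻¹ * W b * k b.tgt) * (u b.tgt)⁻¹ := by rw [hinv]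
      _ = u b.src * (k b.src)⁻¹ * W b * (u b.tgt * (k b.tgt)⁻¹)⁻¹ := by group

/-- ★ **[Balaban1985Variational] PROP. 7 CLAUSE 1 ⟸ «SOME (6)-REGULAR FIBRE POINT IS E–L-CRITICAL AND THE DATUM's SYMMETRIES LIFT TO IT», EVERY BLOCK SIZE `L > 1`,
CONDITIONAL ON THE ONE NAMED FACT** (the proof of ✓pen 7 `atMostOneCriticalOrbit_of_el_symmetriesLift_five` verbatim over the previous theorem).
[cite: Balaban1985Variational, Prop. 7 p.299, (4)-(6) p.278; Balaban1985RegularSpaces, Thm 2 p.83] -/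
theorem atMostOneCriticalOrbit_of_el_symmetriesLift_of_b8Thm2AtT3Members (hX : B8Thm2AtT3Members) (L : ℕ) (hL : 1 < L) :
    ∃ e₈ : ℝ, 0 < e₈ ∧
      ∀ (F : T3Family), F.L = L → ∀ (n K : ℕ) (hnK : n < K) (e : ℝ) (V : GaugeField (F.P n) 0 (Matrix.specialUnitaryGroup (Fin 2) ℂ)),
        0 < e → e ≤ e₈ →
        (∃ W : GaugeField (F.P K) 0 (Matrix.specialUnitaryGroup (Fin 2) ℂ), W ∈ regFibrePr F n K hnK.le e V ∧
          (∀ γ : ℝ → GaugeField (F.P K) 0 (Matrix.specialUnitaryGroup (Fin 2) ℂ), γ 0 = W → (∀ t, γ t ∈ fibre F ℰp n K hnK.le V) →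
            (∀ b, DifferentiableAt ℝ (fun t => ((γ t b : Matrix.specialUnitaryGroup (Fin 2) ℂ) : Matrix (Fin 2) (Fin 2) ℂ)) 0) →
              deriv (fun t => wilsonAction4 (γ t)) 0 = 0) ∧
          (∀ s : GaugeTransf (F.P n) 0 (Matrix.specialUnitaryGroup (Fin 2) ℂ), GaugeField.gaugeAct s V = V →
            ∃ k : GaugeTransf (F.P K) 0 (Matrix.specialUnitaryGroup (Fin 2) ℂ), GaugeField.gaugeAct k W = W ∧ descTransf F n K hnK.le k = s)) →
          (varProblem3 F n K hnK.le).AtMostOneCriticalOrbit e V := by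
  obtain ⟨e₈, he₈, H⟩ := sameOrbit_of_el_of_symmetriesLift_of_b8Thm2AtT3Members hX L hL
  refine ⟨e₈, he₈, ?_⟩
  intro F hF n K hnK e V he heε hex U U' hUreg hUfib hUcrit hU'reg hU'fib hU'crit
  obtain ⟨W, hW, hELW, hlift⟩ := hex
  have hU : U ∈ regFibrePr F n K hnK.le e V := (mem_regFibrePr_iff F).mpr ⟨hUfib, hUreg⟩
  have hU' : U' ∈ regFibrePr F n K hnK.le e V := (mem_regFibrePr_iff F).mpr ⟨hU'fib, hU'reg⟩
  have hELU : ∀ γ : ℝ → GaugeField (F.P K) 0 (Matrix.specialUnitaryGroup (Fin 2) ℂ), γ 0 = U → (∀ t, γ t ∈ fibre F ℰp n K hnK.le V) →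
      (∀ b, DifferentiableAt ℝ (fun t => ((γ t b : Matrix.specialUnitaryGroup (Fin 2) ℂ) : Matrix (Fin 2) (Fin 2) ℂ)) 0) →
        deriv (fun t => wilsonAction4 (γ t)) 0 = 0 :=
    fun γ hγ0 hγfib hγd => deriv_comp_eq_zero_of_isCritR2 hUcrit γ hγ0 hγfib (continuousAt_of_differentiableAt_bonds γ hγd)
  have hELU' : ∀ γ : ℝ → GaugeField (F.P K) 0 (Matrix.specialUnitaryGroup (Fin 2) ℂ), γ 0 = U' → (∀ t, γ t ∈ fibre F ℰp n K hnK.le V) →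
      (∀ b, DifferentiableAt ℝ (fun t => ((γ t b : Matrix.specialUnitaryGroup (Fin 2) ℂ) : Matrix (Fin 2) (Fin 2) ℂ)) 0) →
        deriv (fun t => wilsonAction4 (γ t)) 0 = 0 :=
    fun γ hγ0 hγfib hγd => deriv_comp_eq_zero_of_isCritR2 hU'crit γ hγ0 hγfib (continuousAt_of_differentiableAt_bonds γ hγd)
  have h1 : SameOrbit F n K hnK.le W U := H F hF n K hnK e V W U he heε hW hELW hlift hU hELU
  have h2 : SameOrbit F n K hnK.le W U' := H F hF n K hnK e V W U' he heε hW hELW hlift hU' hELU'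
  exact sameOrbit_trans F hnK.le (sameOrbit_symm F hnK.le h1) h2

/-! ## §3 ★★ The structured split `v • W′ = u • W` of two E–L-critical regular points, at every block size from the name -/

/-- ★★ **TWO E–L-CRITICAL REGULAR POINTS OVER ONE DATUM: THE STRUCTURED GAUGE RELATION `v • W′ = u • W`, EVERY BLOCK SIZE `L > 1`, CONDITIONAL ON THE ONE NAMED
FACT** (`v = 1` at every `(K−n)`-centre, `u` (1.29)-restricted relative to `W`, `v • W′` in the iterated axial gauge (1.19) relative to `W`) — the proof of ✓px13 g21
`criticalRep_split_five` verbatim: brick 1 (§1) gives `v • W′ = u • (e^{iX}·W)`, `A(W′) = A(e^{iX}·W)`; (142) with its rate at `W` (✓`sigmaGrowth_holds`, all `L`) and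
the orbit growth at `W′` over the competitor `W` (§1) give `c·ℓ⁻²·Σ‖X_b‖² ≤ A(W′) − A(W) ≤ 0`, so `X = 0`.
[cite: Balaban1985Variational, (141)-(143) p.299, Prop. 2 p.281, (18)-(21) pp.280-281; Balaban1985RegularSpaces, Thm 2 p.83, (1.29) p.81, (1.19) p.79] -/
theorem criticalRep_split_of_b8Thm2AtT3Members (hX : B8Thm2AtT3Members) (L : ℕ) (hL : 1 < L) :
    ∃ e₈ : ℝ, 0 < e₈ ∧
      ∀ (F : T3Family), F.L = L → ∀ (n K : ℕ) (hnK : n < K) (e : ℝ) (V : GaugeField (F.P n) 0 (Matrix.specialUnitaryGroup (Fin 2) ℂ))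
        (W W' : GaugeField (F.P K) 0 (Matrix.specialUnitaryGroup (Fin 2) ℂ)),
        0 < e → e ≤ e₈ → W ∈ regFibrePr F n K hnK.le e V →
        (∀ γ : ℝ → GaugeField (F.P K) 0 (Matrix.specialUnitaryGroup (Fin 2) ℂ), γ 0 = W → (∀ t, γ t ∈ fibre F ℰp n K hnK.le V) →
          (∀ b, DifferentiableAt ℝ (fun t => ((γ t b : Matrix.specialUnitaryGroup (Fin 2) ℂ) : Matrix (Fin 2) (Fin 2) ℂ)) 0) →
            deriv (fun t => wilsonAction4 (γ t)) 0 = 0) →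
        W' ∈ regFibrePr F n K hnK.le e V →
        (∀ γ : ℝ → GaugeField (F.P K) 0 (Matrix.specialUnitaryGroup (Fin 2) ℂ), γ 0 = W' → (∀ t, γ t ∈ fibre F ℰp n K hnK.le V) →
          (∀ b, DifferentiableAt ℝ (fun t => ((γ t b : Matrix.specialUnitaryGroup (Fin 2) ℂ) : Matrix (Fin 2) (Fin 2) ℂ)) 0) →
            deriv (fun t => wilsonAction4 (γ t)) 0 = 0) →
          ∃ (v u : GaugeTransf (F.P K) 0 (Matrix.specialUnitaryGroup (Fin 2) ℂ)),
            (∀ y : Site (F.P K) (K - n), v (embIter (K - n) y) = 1) ∧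
            RestrictedPrint F n K W u ∧ IsAxialPrint F n K W (GaugeField.gaugeAct v W') ∧
            GaugeField.gaugeAct v W' = GaugeField.gaugeAct u W := by
  obtain ⟨B₁', c₁', hB₁', hc₁', HREP⟩ := exists_sigmaRep_split_of_b8Thm2AtT3Members hX L hL
  obtain ⟨e₇, c, he₇, hc, HGROW⟩ := sigmaGrowth_holds L hL B₁' hB₁'
  obtain ⟨e₈, c', he₈, hc', HORB⟩ := orbitGrowth_of_regular_of_b8Thm2AtT3Members hX L hL
  have hC0 : 0 < C0 3 := C0_pos 3
  have hc2 : 0 < c2' 3 L := c2'_pos 3 L (by omega)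
  refine ⟨min e₈ (min e₇ (min (c₁' / 2) (min (1 / (6 * C0 3)) (c2' 3 L / 4)))),
    lt_min he₈ (lt_min he₇ (lt_min (by positivity) (lt_min (by positivity) (by positivity)))), ?_⟩
  intro F hF n K hnK e V W W' he hee hW hELW hW' hELW'
  have he₈' : e ≤ e₈ := hee.trans (min_le_left _ _)
  have he₇' : e ≤ e₇ := (hee.trans (min_le_right _ _)).trans (min_le_left _ _)
  have h3 := (hee.trans (min_le_right _ _)).trans (min_le_right _ _)
  have h2e : 2 * e ≤ c₁' := by have := h3.trans (min_le_left _ _); linarith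
  have hα3 : C0 3 * (2 * e) ≤ 1 / 3 := by
    have h1 : e ≤ 1 / (6 * C0 3) := (h3.trans (min_le_right _ _)).trans (min_le_left _ _)
    rw [le_div_iff₀ (by positivity)] at h1
    linarith
  have hα2 : 2 * (2 * e) ≤ c2' 3 L := by
    have h1 : e ≤ c2' 3 L / 4 := (h3.trans (min_le_right _ _)).trans (min_le_right _ _)
    linarith
  -- brick 1: the Σ-representation of `W′` at background `W`, gauge split kept
  obtain ⟨v, u, X, hv1, -, hrestr, hax, -, hvW', h19, h20, h21, hA⟩ := HREP F hF n K hnK e V W he h2e hα3 hα2 hW W' hW'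
  -- (142) at `W` for this `X`, and the growth at `W′` with competitor `W`: equal actions, `X = 0`
  have hgrow := HGROW F hF n K hnK e V W X he he₇' hW hELW h19 h20 h21
  obtain ⟨u₀, hu₀⟩ := HORB F hF n K hnK e V W' he he₈' hW' hELW' W hW
  have hℓ : (0 : ℝ) < ((F.L : ℝ) ^ (K - n)) ^ 2 := by
    have hL0 : (0 : ℝ) < (F.L : ℝ) := by have := F.hL.2; exact_mod_cast (by omega : 0 < F.L)
    positivity
  have hS0 : 0 ≤ ∑ ℓ : PBond (F.P K) 0, dist1 (W ℓ * ((GaugeField.gaugeAct u₀ W') ℓ)⁻¹) ^ 2 := Finset.sum_nonneg fun _ _ => sq_nonneg _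
  have hle : wilsonAction4 W' - wilsonAction4 W ≤ 0 := by
    have := (mul_nonneg (mul_nonneg hc'.le (inv_nonneg.mpr hℓ.le)) hS0).trans hu₀
    linarith
  have hX0 : ∑ b : PBond (F.P K) 0, ‖X b‖ ^ 2 = 0 := by
    have h1 : c * (((F.L : ℝ) ^ (K - n)) ^ 2)⁻¹ * ∑ b : PBond (F.P K) 0, ‖X b‖ ^ 2 ≤ 0 := by rw [hA] at hle; exact hgrow.trans hle
    have hpos : 0 < c * (((F.L : ℝ) ^ (K - n)) ^ 2)⁻¹ := mul_pos hc (inv_pos.mpr hℓ)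
    have hS : 0 ≤ ∑ b : PBond (F.P K) 0, ‖X b‖ ^ 2 := Finset.sum_nonneg fun _ _ => sq_nonneg _
    nlinarith
  have hXb : ∀ b : PBond (F.P K) 0, X b = 0 := by
    intro b
    have h1 := (Finset.sum_eq_zero_iff_of_nonneg fun b _ => sq_nonneg (‖X b‖)).1 hX0 b (Finset.mem_univ b)
    exact norm_eq_zero.1 (pow_eq_zero_iff (n := 2) (by norm_num) |>.1 h1)
  have hemb : emb15 W (expHermField X) = W := by
    funext b
    show expHermField X b * W b = W b
    rw [expHermField_apply, hXb b, expHerm_zero, one_mul]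
  refine ⟨v, u, hv1, hrestr, hax, ?_⟩
  rw [hvW', hemb]

end Summit.QuantumFields.YangMills.Theorems.FluctuationComparisonRegPrIntLS2BetaCriticalOrbitOfB8Thm2AtT3Members

end
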